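import Literature.NumberTheory.Sieve.PolymathFormsMaynard
import HarnessLib

/-!
# Polymath 8b §7: integer mirrors of the exact forms at `ε = 0`, and a kernel certificate criterion

Topic `Literature/NumberTheory/Sieve`.  `PolymathFormsMaynard.lean` identifies Maynard's `I_k(F)`,
`J_k^{(m)}(F)` for `F = 1_{R_k} · Q`, `Q = ∑_{i,a ≤ D} A_{i,a} (1 − P₁)^a ∏_p p_{v_p}^{ν_{i,p}}`, with the
finite rational sums `MkEps.iForm v k 1 D A ν`, `MkEps.jForm v (k−1) 1 1 D A ν`.  This file clears their
denominators against one factorial `N!`, exactly as `MaynardK105.lean` does for Maynard's two-power-sum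
basis ("using only exact arithmetic", Maynard §7; Polymath 8b §7.1 p. 30: "we then do the quick (and exact)
arithmetic"), giving kernel-computable integers for INTEGER coefficient data `A : Fin d → ℕ → ℤ`:

* `MkEps.ival_one`, `MkEps.mom_one_one` — at `r = ρ = 1` the moments collapse to
  `A! S_K(c)/(K+A+deg c)!` and `E! S_n(c)/(n+E+deg c)!`;
* `MkEps.mirrorI v K N D A ν : ℤ` and `MkEps.factorial_mul_iForm` — `N! · iForm = mirrorI` once
  `K + 2D + deg ν_i + deg ν_{i'} ≤ N`;
* `MkEps.mirrorJ v n N D A ν : ℤ` and `MkEps.factorial_mul_jForm` — `N! · jForm = mirrorJ` once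
  `n + 2D + 2 + deg ν_i + deg ν_{i'} ≤ N`;
* `MkEps.isMaynardAdmissible_and_lt_of_mirror` — **kernel criterion**: `0 < mirrorI` and
  `p · mirrorI < q·k · mirrorJ` give an admissible `F` on `R_k` with `maynardFunctional k F > p/q`; and
  `MkEps.weakDHL_of_mirror` — with `p/q = 4m`: `DHL[k, m+1]` unconditionally (`MkEps.weakDHL_of_forms`);
* a worked instance, `MkEps.two_lt_maynardFunctional_five_psCert`: Maynard's `k = 5` polynomial
  (Annals (7.21)) in this data format, `2 < (∑ J)/I` by `decide +kernel` — the same numbers as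
  `MaynardK105.isMaynardAdmissible_and_two_lt_cert5`, through the general-signature pipeline.

All proved, no new facts.  Scope: `MkEps.dSgen` is evaluated by the kernel straight from its defining
recursion (sums over `Fintype.piFinset`), which is adequate for validation-size data; a production
certificate with thousands of basis functions needs a tabulated evaluator in the style of
`PolymathBoundedGapsCert.lean`.

## References

* D. H. J. Polymath, *Variants of the Selberg sieve, and bounded intervals containing many primes*,
  Res. Math. Sci. 1 (2014), Art. 12 = arXiv:1407.4897, §7.1 (p. 30), Lemma 7.2. [Polymath8b2014]
* J. Maynard, *Small gaps between primes*, Ann. of Math. 181 (2015), §7 (proof of Prop. 4.3),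
  eq. (7.21). [MaynardAnnals2015]
-/

open MeasureTheory Set Filter Finset
open scoped BigOperators

namespace Literature.NumberTheory.Sieve

namespace MkEps

open MaynardK105 (facRatio binomK factorial_mul_facRatio binomK_eq_choose)

variable {P : ℕ}

/-! ### The moments at `r = ρ = 1` -/

/-- `Ival(A, c) = A! S_K(c)/(K + A + deg c)!` at `r = 1`. [cite: Polymath8b2014, Lemma 7.2] -/
theorem ival_one (v : Fin P → ℕ) (K A : ℕ) (c : Fin P → ℕ) :
    ival v K 1 A c = ((A.factorial * dSgen v K c : ℕ) : ℝ) / (K + A + psDeg v c).factorial := by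
  rw [ival, one_pow, one_mul]

/-- `Mom(E, c) = E! S_n(c)/(n + E + deg c)!` at `r = ρ = 1` (only the top term of the binomial
expansion in `r − ρ = 0` survives). [cite: Polymath8b2014, Lemma 7.2] -/
theorem mom_one_one (v : Fin P → ℕ) (n E : ℕ) (c : Fin P → ℕ) :
    mom v n 1 1 E c = ((E.factorial * dSgen v n c : ℕ) : ℝ) / (n + E + psDeg v c).factorial := by
  rw [mom, one_pow, one_mul, Finset.sum_eq_single_of_mem E (Finset.mem_range.2 (Nat.lt_succ_self E))]
  · simp
  · intro B hB hne
    have hlt : B < E := lt_of_le_of_ne (Nat.lt_succ_iff.1 (Finset.mem_range.1 hB)) hne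
    simp [sub_self, zero_pow (Nat.sub_ne_zero_of_lt hlt)]

/-! ### Integer mirrors -/

section Mirror

variable {d : ℕ}

/-- `N! · I_k(F)` as an exact integer for integer coefficients: every term
`A A' · (a+a')! S_K(ν_i+ν_{i'})/(K+a+a'+deg)!` of `iForm` with the denominator replaced by `N!/(…)!`.
[cite: Polymath8b2014, §7.1 (exact arithmetic, p. 30)] -/
def mirrorI (v : Fin P → ℕ) (K N D : ℕ) (A : Fin d → ℕ → ℤ) (ν : Fin d → Fin P → ℕ) : ℤ :=
  ∑ x ∈ iIndex (Fin d) D, ∑ y ∈ iIndex (Fin d) D, A x.1 x.2 * A y.1 y.2 *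
    ((((x.2 + y.2).factorial * dSgen v K (ν x.1 + ν y.1) *
      facRatio N (K + (x.2 + y.2) + psDeg v (ν x.1 + ν y.1)) : ℕ) : ℤ))

/-- `N! · J_k^{(m)}(F)` (`k = n + 1`) as an exact integer for integer coefficients: every term
`gCoef(x) gCoef(y) Mom` of `jForm` with `(E_x+E_y)!/(E_x! E_y!) = binomK` and `N!/(…)! = facRatio`.
[cite: Polymath8b2014, §7.1 (exact arithmetic, p. 30)] -/
def mirrorJ (v : Fin P → ℕ) (n N D : ℕ) (A : Fin d → ℕ → ℤ) (ν : Fin d → Fin P → ℕ) : ℤ :=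
  ∑ x ∈ gIndex D ν, ∑ y ∈ gIndex D ν, A x.1.1 x.2 * A y.1.1 y.2 *
    ((((∏ p, (ν x.1.1 p).choose (x.1.2 p)) * (x.2.factorial * (∑ p, v p * x.1.2 p).factorial) *
      ((∏ p, (ν y.1.1 p).choose (y.1.2 p)) * (y.2.factorial * (∑ p, v p * y.1.2 p).factorial)) *
      binomK (gExp v x + gExp v y) (gExp v x) * dSgen v n (gVec ν x + gVec ν y) *
      facRatio N (n + (gExp v x + gExp v y) + psDeg v (gVec ν x + gVec ν y)) : ℕ) : ℤ))

/-- Per-term bridge for `I`: `N! · (a a' · (M S/x!)) = a a' · (M S · N!/x!)` for `x ≤ N`. [folklore] -/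
private theorem bridgeI_term (a a' : ℤ) {M S x N : ℕ} (hx : x ≤ N) :
    ((N.factorial : ℕ) : ℝ) * ((a : ℝ) * a' * (((M * S : ℕ) : ℝ) / x.factorial)) =
      ((a * a' * ((M * S * facRatio N x : ℕ) : ℤ) : ℤ) : ℝ) := by
  have hR : ((x.factorial : ℕ) : ℝ) * (facRatio N x : ℕ) = (N.factorial : ℕ) := by
    exact_mod_cast factorial_mul_facRatio hx
  rw [← hR]
  have hx0 : ((x.factorial : ℕ) : ℝ) ≠ 0 := by exact_mod_cast x.factorial_ne_zero
  push_cast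
  field_simp

/-- The real identity behind `bridgeJ_term`. [folklore] -/
private theorem bridgeJ_aux {a a' ch p ch' p' E1 E2 EE S X R NF BK : ℝ}
    (hX : X ≠ 0) (h1 : E1 ≠ 0) (h2 : E2 ≠ 0) (hR : X * R = NF) (hB : BK * E1 * E2 = EE) :
    NF * ((a * ch * (p / E1)) * (a' * ch' * (p' / E2)) * (EE * S / X)) =
      a * a' * (ch * p * (ch' * p') * BK * S * R) := by
  subst hR hB
  calc X * R * (a * ch * (p / E1) * (a' * ch' * (p' / E2)) * (BK * E1 * E2 * S / X))
      = (X * X⁻¹) * (E1 * E1⁻¹) * (E2 * E2⁻¹) * (a * a' * (ch * p * (ch' * p') * BK * S * R)) := by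
        ring
    _ = a * a' * (ch * p * (ch' * p') * BK * S * R) := by
      rw [mul_inv_cancel₀ hX, mul_inv_cancel₀ h1, mul_inv_cancel₀ h2, one_mul, one_mul, one_mul]

/-- Per-term bridge for `J`: clearing the three factorial denominators of a term of `jForm` against
`N!`, for `x ≤ N`. [folklore] -/
private theorem bridgeJ_term (a a' : ℤ) {ch p ch' p' e₁ e₂ S x N : ℕ} (hx : x ≤ N) :
    ((N.factorial : ℕ) : ℝ) *
        ((((a : ℝ) * (ch : ℕ) * (((p : ℕ) : ℝ) / e₁.factorial)) *
          ((a' : ℝ) * (ch' : ℕ) * (((p' : ℕ) : ℝ) / e₂.factorial))) *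
         ((((e₁ + e₂).factorial * S : ℕ) : ℝ) / x.factorial)) =
      ((a * a' * ((ch * p * (ch' * p') * binomK (e₁ + e₂) e₁ * S * facRatio N x : ℕ) : ℤ) : ℤ) : ℝ) := by
  have hR : ((x.factorial : ℕ) : ℝ) * (facRatio N x : ℕ) = (N.factorial : ℕ) := by
    exact_mod_cast factorial_mul_facRatio hx
  have hB : ((binomK (e₁ + e₂) e₁ : ℕ) : ℝ) * (e₁.factorial : ℕ) * (e₂.factorial : ℕ) =
      ((e₁ + e₂).factorial : ℕ) := by
    rw [binomK_eq_choose]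
    have := Nat.choose_mul_factorial_mul_factorial (n := e₁ + e₂) (k := e₁) (by omega)
    rw [Nat.add_sub_cancel_left] at this
    exact_mod_cast this
  have hx0 : ((x.factorial : ℕ) : ℝ) ≠ 0 := by exact_mod_cast x.factorial_ne_zero
  have h10 : ((e₁.factorial : ℕ) : ℝ) ≠ 0 := by exact_mod_cast e₁.factorial_ne_zero
  have h20 : ((e₂.factorial : ℕ) : ℝ) ≠ 0 := by exact_mod_cast e₂.factorial_ne_zero
  have key := bridgeJ_aux (a := (a : ℝ)) (a' := (a' : ℝ)) (ch := ((ch : ℕ) : ℝ)) (p := ((p : ℕ) : ℝ))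
    (ch' := ((ch' : ℕ) : ℝ)) (p' := ((p' : ℕ) : ℝ)) (S := (S : ℝ)) hx0 h10 h20 hR hB
  push_cast at key ⊢
  exact key

/-- **Bridge for `I`**: `N! · iForm v K 1 D A ν = mirrorI v K N D A ν` whenever `N` clears all the
denominators (`K + 2D + deg ν_i + deg ν_{i'} ≤ N`). [cite: Polymath8b2014, §7.1 (exact arithmetic, p. 30)] -/
theorem factorial_mul_iForm (v : Fin P → ℕ) (K N D : ℕ) (A : Fin d → ℕ → ℤ) (ν : Fin d → Fin P → ℕ)
    (hN : ∀ i i', K + 2 * D + psDeg v (ν i) + psDeg v (ν i') ≤ N) :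
    ((N.factorial : ℕ) : ℝ) * iForm v K 1 D (fun i a => (A i a : ℝ)) ν = (mirrorI v K N D A ν : ℝ) := by
  rw [iForm, mirrorI, Finset.mul_sum, Int.cast_sum]
  refine Finset.sum_congr rfl fun x hx => ?_
  rw [Finset.mul_sum, Int.cast_sum]
  refine Finset.sum_congr rfl fun y hy => ?_
  have hxD : x.2 ≤ D := Nat.lt_succ_iff.1 (Finset.mem_range.1 (Finset.mem_product.1 hx).2)
  have hyD : y.2 ≤ D := Nat.lt_succ_iff.1 (Finset.mem_range.1 (Finset.mem_product.1 hy).2)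
  have hle : K + (x.2 + y.2) + psDeg v (ν x.1 + ν y.1) ≤ N := by
    have := hN x.1 y.1; rw [psDeg_add]; omega
  rw [ival_one]
  exact bridgeI_term (A x.1 x.2) (A y.1 y.2) hle

/-- **Bridge for `J`**: `N! · jForm v n 1 1 D A ν = mirrorJ v n N D A ν` whenever
`n + 2D + 2 + deg ν_i + deg ν_{i'} ≤ N`. [cite: Polymath8b2014, §7.1 (exact arithmetic, p. 30)] -/
theorem factorial_mul_jForm (v : Fin P → ℕ) (n N D : ℕ) (A : Fin d → ℕ → ℤ) (ν : Fin d → Fin P → ℕ)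
    (hN : ∀ i i', n + 2 * D + 2 + psDeg v (ν i) + psDeg v (ν i') ≤ N) :
    ((N.factorial : ℕ) : ℝ) * jForm v n 1 1 D (fun i a => (A i a : ℝ)) ν = (mirrorJ v n N D A ν : ℝ) := by
  rw [jForm, mirrorJ, Finset.mul_sum, Int.cast_sum]
  refine Finset.sum_congr rfl fun x hx => ?_
  rw [Finset.mul_sum, Int.cast_sum]
  refine Finset.sum_congr rfl fun y hy => ?_
  obtain ⟨hx1, hx2⟩ := Finset.mem_product.1 hx
  obtain ⟨hy1, hy2⟩ := Finset.mem_product.1 hy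
  have hxD : x.2 ≤ D := Nat.lt_succ_iff.1 (Finset.mem_range.1 hx2)
  have hyD : y.2 ≤ D := Nat.lt_succ_iff.1 (Finset.mem_range.1 hy2)
  have hjx : ∀ p, x.1.2 p ≤ ν x.1.1 p := le_of_mem_box (Finset.mem_sigma.1 hx1).2
  have hjy : ∀ p, y.1.2 p ≤ ν y.1.1 p := le_of_mem_box (Finset.mem_sigma.1 hy1).2
  have hdx := psDeg_sub_add v hjx
  have hdy := psDeg_sub_add v hjy
  have hle : n + (gExp v x + gExp v y) + psDeg v (gVec ν x + gVec ν y) ≤ N := by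
    have := hN x.1.1 y.1.1
    rw [psDeg_add]
    simp only [gExp, gVec] at *
    omega
  rw [mom_one_one, gCoef, gCoef, ← Nat.cast_prod, ← Nat.cast_prod]
  simp only [gExp] at hle ⊢
  exact bridgeJ_term (A x.1.1 x.2) (A y.1.1 y.2) hle

/-- **From an exact-arithmetic certificate to Maynard's functional** (general signatures): if the
integer mirrors satisfy `0 < N!·I` and `p · (N!·I) < q·k · (N!·J)` (`q > 0`), then `F = 1_{R_k} · Q` is
admissible and `(∑_m J_k^{(m)}(F))/I_k(F) > p/q`. [cite: Polymath8b2014, §7.1 (exact verification of (7.4), p. 30)] -/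
theorem isMaynardAdmissible_and_lt_of_mirror (v : Fin P → ℕ) (n N D : ℕ) (A : Fin d → ℕ → ℤ)
    (ν : Fin d → Fin P → ℕ) (hN : ∀ i i', n + 2 * D + 2 + psDeg v (ν i) + psDeg v (ν i') ≤ N)
    (p q : ℕ) (hq : 0 < q) (hI : 0 < mirrorI v (n + 1) N D A ν)
    (hJ : (p : ℤ) * mirrorI v (n + 1) N D A ν < ((q * (n + 1) : ℕ) : ℤ) * mirrorJ v n N D A ν) :
    IsMaynardAdmissible (n + 1)
        ((maynardSimplex (n + 1)).indicator (qPoly v 1 D (fun i a => (A i a : ℝ)) ν)) ∧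
      (p : ℝ) / q < maynardFunctional (n + 1)
        ((maynardSimplex (n + 1)).indicator (qPoly v 1 D (fun i a => (A i a : ℝ)) ν)) := by
  have hIval := factorial_mul_iForm v (n + 1) N D A ν (fun i i' => by have := hN i i'; omega)
  have hJval := factorial_mul_jForm v n N D A ν hN
  have hNpos : (0 : ℝ) < (N.factorial : ℕ) := by exact_mod_cast N.factorial_pos
  have hqpos : (0 : ℝ) < q := by exact_mod_cast hq
  have hIpos : 0 < iForm v (n + 1) 1 D (fun i a => (A i a : ℝ)) ν := by
    have h : (0 : ℝ) < ((N.factorial : ℕ) : ℝ) * iForm v (n + 1) 1 D (fun i a => (A i a : ℝ)) ν := by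
      rw [hIval]; exact_mod_cast hI
    exact pos_of_mul_pos_right h hNpos.le
  refine lt_maynardFunctional_of_forms n v D _ ν hIpos ?_
  -- `p/q · I < (n+1) · J`, from the integer inequality after multiplying by `q · N! > 0`
  set I := iForm v (n + 1) 1 D (fun i a => (A i a : ℝ)) ν with hIdef
  set J := jForm v n 1 1 D (fun i a => (A i a : ℝ)) ν with hJdef
  have hJ' : (p : ℝ) * (((N.factorial : ℕ) : ℝ) * I) < ((q * (n + 1) : ℕ) : ℝ) * (((N.factorial : ℕ) : ℝ) * J) := by
    rw [hIval, hJval]; exact_mod_cast hJ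
  have key : (p : ℝ) * I < (q : ℝ) * ((((n + 1 : ℕ) : ℝ)) * J) := by
    refine lt_of_mul_lt_mul_left (a := ((N.factorial : ℕ) : ℝ)) ?_ hNpos.le
    have e1 : ((N.factorial : ℕ) : ℝ) * ((p : ℝ) * I) = (p : ℝ) * (((N.factorial : ℕ) : ℝ) * I) := by ring
    have e2 : ((N.factorial : ℕ) : ℝ) * ((q : ℝ) * ((((n + 1 : ℕ) : ℝ)) * J)) =
        ((q * (n + 1) : ℕ) : ℝ) * (((N.factorial : ℕ) : ℝ) * J) := by push_cast; ring
    rw [e1, e2]; exact hJ'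
  rw [div_mul_eq_mul_div, div_lt_iff₀ hqpos]
  calc (p : ℝ) * I < (q : ℝ) * ((((n + 1 : ℕ) : ℝ)) * J) := key
    _ = (((n + 1 : ℕ) : ℝ)) * J * q := by ring

/-- **`DHL[k, m+1]` from an integer certificate**: `0 < N!·I` and `4m · (N!·I) < k · (N!·J)` give
`DHL[k, m+1]` unconditionally (`MkEps.weakDHL_of_forms`). [cite: Polymath8b2014, Theorem 3.8 (with §7.1)] -/
theorem weakDHL_of_mirror (v : Fin P → ℕ) (n m N D : ℕ) (A : Fin d → ℕ → ℤ) (ν : Fin d → Fin P → ℕ)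
    (hN : ∀ i i', n + 2 * D + 2 + psDeg v (ν i) + psDeg v (ν i') ≤ N)
    (hI : 0 < mirrorI v (n + 1) N D A ν)
    (hJ : ((4 * m : ℕ) : ℤ) * mirrorI v (n + 1) N D A ν < ((n + 1 : ℕ) : ℤ) * mirrorJ v n N D A ν) :
    WeakDicksonHardyLittlewood (n + 1) (m + 1) := by
  have hNpos : (0 : ℝ) < (N.factorial : ℕ) := by exact_mod_cast N.factorial_pos
  have hIval := factorial_mul_iForm v (n + 1) N D A ν (fun i i' => by have := hN i i'; omega)
  have hJval := factorial_mul_jForm v n N D A ν hN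
  have hIpos : 0 < iForm v (n + 1) 1 D (fun i a => (A i a : ℝ)) ν := by
    have h : (0 : ℝ) < ((N.factorial : ℕ) : ℝ) * iForm v (n + 1) 1 D (fun i a => (A i a : ℝ)) ν := by
      rw [hIval]; exact_mod_cast hI
    exact pos_of_mul_pos_right h hNpos.le
  refine weakDHL_of_forms n m v D _ ν hIpos ?_
  set I := iForm v (n + 1) 1 D (fun i a => (A i a : ℝ)) ν with hIdef
  set J := jForm v n 1 1 D (fun i a => (A i a : ℝ)) ν with hJdef
  have hJ' : ((4 * m : ℕ) : ℝ) * (((N.factorial : ℕ) : ℝ) * I) < ((n + 1 : ℕ) : ℝ) * (((N.factorial : ℕ) : ℝ) * J) := by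
    rw [hIval, hJval]; exact_mod_cast hJ
  refine lt_of_mul_lt_mul_left (a := ((N.factorial : ℕ) : ℝ)) ?_ hNpos.le
  have e1 : ((N.factorial : ℕ) : ℝ) * (4 * (m : ℝ) * I) = ((4 * m : ℕ) : ℝ) * (((N.factorial : ℕ) : ℝ) * I) := by
    push_cast; ring
  have e2 : ((N.factorial : ℕ) : ℝ) * ((((n + 1 : ℕ) : ℝ)) * J) = ((n + 1 : ℕ) : ℝ) * (((N.factorial : ℕ) : ℝ) * J) := by
    ring
  rw [e1, e2]; exact hJ'

end Mirror

/-! ### Worked instance: Maynard's `k = 5` polynomial through the general pipeline -/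

section Five

/-- One power sum, `p₂`. [cite: MaynardAnnals2015, eq. (7.21)] -/
def fiveV : Fin 1 → ℕ := ![2]

/-- Two groups: `P₂¹` and `P₂⁰`. [cite: MaynardAnnals2015, eq. (7.21)] -/
def fiveNu : Fin 2 → Fin 1 → ℕ := ![![1], ![0]]

/-- `70 ×` the coefficients of Maynard's `(1 − P₁)P₂ + 7/10 (1 − P₁)² + 1/14 P₂ − 3/14 (1 − P₁)`:
group `P₂`: `5 + 70 (1 − P₁)`; group `1`: `−15 (1 − P₁) + 49 (1 − P₁)²`. [cite: MaynardAnnals2015, eq. (7.21)] -/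
def fiveA : Fin 2 → ℕ → ℤ := fun i a => (![[5, 70, 0], [0, -15, 49]] i).getD a 0

/-- The exact-arithmetic claim `2 · (14!·I) < 5 · (14!·J)` for Maynard's `k = 5` data in the
power-sum-product format, by kernel evaluation. [cite: MaynardAnnals2015, §7 (M₅ > 2)] -/
theorem five_psCert_lt :
    (2 : ℤ) * mirrorI fiveV 5 14 2 fiveA fiveNu < ((1 * (4 + 1) : ℕ) : ℤ) * mirrorJ fiveV 4 14 2 fiveA fiveNu := by
  decide +kernel

/-- `14! · I > 0` for the `k = 5` data. [cite: MaynardAnnals2015, §7 (M₅ > 2)] -/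
theorem five_psCert_pos : 0 < mirrorI fiveV 5 14 2 fiveA fiveNu := by
  decide +kernel

/-- **`M₅ > 2` through the general-signature pipeline**: Maynard's polynomial, encoded as power-sum
product data, gives an admissible `F` on `R₅` with `(∑ J)/I > 2` — the same test function and value
(`1417255/708216`) as `MaynardK105.isMaynardAdmissible_and_two_lt_cert5`. [cite: MaynardAnnals2015, §7, Prop. 4.3 (1)] -/
theorem two_lt_maynardFunctional_five_psCert :
    IsMaynardAdmissible 5
        ((maynardSimplex 5).indicator (qPoly fiveV 1 2 (fun i a => (fiveA i a : ℝ)) fiveNu)) ∧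
      (2 : ℝ) < maynardFunctional 5
        ((maynardSimplex 5).indicator (qPoly fiveV 1 2 (fun i a => (fiveA i a : ℝ)) fiveNu)) := by
  have h := isMaynardAdmissible_and_lt_of_mirror fiveV 4 14 2 fiveA fiveNu (by decide) 2 1 one_pos
    five_psCert_pos five_psCert_lt
  simpa using h

end Five

end MkEps

end Literature.NumberTheory.Sieve
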